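import Literature.AlgebraicGeometry.Resolution.AlterationsNormalFormBlowupParts
import HarnessLib

/-!
# `WildQuotients.SummitReduction` (stmt-ResolutionOfSingularities-16324), line `FramePerfect`, stub S
# (`stub_pair_orbitNormalFormBlowup`): counting singular components through the strict transforms
# of a blow-up whose centre is a union of components

Route `ResolutionOfSingularities/WildQuotients`, crux `SummitReduction`; helper file of the line
skeleton (v8), stub S = the orbit version of de Jong 1996, Claim 4.27 (de Jong 1997, proof of
Prop. 5.11 ¶3: "Thus we blow up in orbits of components of the singular locus of `X`").

De Jong 1996, 4.27 (p. 75): "Let `E' ⊂ X` be another irreducible component of the singular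
locus of `X`. Let `Ẽ' ⊂ X'` be the strict transform of `E'`. … Then `Sing(X')` is the union of
the `Ẽ'` so obtained", whence "The number of components of `Sing(X')` is one less than the
number of components of `Sing(X)`". The tree proves this count for a centre which is ONE
component (`ncard_componentsIn_of_eq_biUnion_strictTransformSet`,
`AlterationsNormalFormBlowupParts.lean`). In the equivariant iteration the centre is the orbit of
a component, i.e. the union `C = ⋃₀ 𝒪` of a non-empty SUBFAMILY `𝒪` of the irreducible
components of the closed set `S = Sing X`; this file proves the count in that generality (step
(S4) of the stub, pure topology): if `π : X' → X` is an isomorphism over `X ∖ C` and the set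
`S' ⊆ X'` is the union of the strict transforms `closure π⁻¹(E' ∖ C)` of the components
`E' ∉ 𝒪` of `S`, then

* `componentsIn_eq_image_strictTransformSet_of_sUnion` — the components of `S'` are exactly these
  strict transforms (irreducible, closed, pairwise incomparable), and
* `ncard_componentsIn_add_of_sUnion` — `#S' + #𝒪 = #S` on components, so
* `ncard_componentsIn_lt_of_sUnion` — `#S' < #S` as soon as `𝒪` is non-empty.

## Sources

* A. J. de Jong, *Smoothness, semi-stability and alterations*, Publ. Math. IHÉS 83 (1996), 4.27,
  pp. 75–76. [DeJong1996]
* A. J. de Jong, *Families of curves and alterations*, Ann. Inst. Fourier 47 (1997), proof of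
  Prop. 5.11, p. 619. [DeJong1997]
-/

set_option linter.dupNamespace false -- the tree's summit namespace repeats `ResolutionOfSingularities`

noncomputable section

open CategoryTheory CategoryTheory.Limits AlgebraicGeometry TopologicalSpace Topology
open Literature.AlgebraicGeometry.Resolution
open Literature.AlgebraicGeometry

namespace Summit.ResolutionOfSingularities.ResolutionOfSingularities.Theorems

variable {X' X : Scheme.{0}} (π : X' ⟶ X) {S : Set X} {𝒪 : Set (Set X)}

/-- A finite union of components of a closed set is closed. [folklore] -/
theorem isClosed_sUnion_of_subset_componentsIn (hS : IsClosed S) (hfin : (componentsIn S).Finite)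
    (h𝒪 : 𝒪 ⊆ componentsIn S) : IsClosed (⋃₀ 𝒪) := by
  rw [Set.sUnion_eq_biUnion]
  exact (hfin.subset h𝒪).isClosed_biUnion fun T hT => componentsIn.isClosed hS (h𝒪 hT)

/-- **A component of `S` outside the subfamily `𝒪` is not contained in `⋃₀ 𝒪`**: an
irreducible set inside a finite union of closed sets lies in one of them, and distinct
components are incomparable. [folklore] -/
theorem diff_sUnion_nonempty_of_notMem (hS : IsClosed S) (hfin : (componentsIn S).Finite)
    (h𝒪 : 𝒪 ⊆ componentsIn S) {E' : Set X} (hE' : E' ∈ componentsIn S) (hE'𝒪 : E' ∉ 𝒪) :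
    (E' \ ⋃₀ 𝒪).Nonempty := by
  by_contra h
  rw [Set.not_nonempty_iff_eq_empty, Set.sdiff_eq_empty] at h
  have h𝒪fin : 𝒪.Finite := hfin.subset h𝒪
  obtain ⟨T, hT, hE'T⟩ := isIrreducible_iff_sUnion_isClosed.mp (componentsIn.isIrreducible hE')
    h𝒪fin.toFinset (fun T hT => componentsIn.isClosed hS (h𝒪 (h𝒪fin.mem_toFinset.mp hT)))
    (by simpa using h)
  have hT𝒪 : T ∈ 𝒪 := h𝒪fin.mem_toFinset.mp hT
  have hne : E' ≠ T := by
    rintro rfl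
    exact hE'𝒪 hT𝒪
  exact not_subset_of_mem_componentsIn_of_ne (h𝒪 hT𝒪) hE' hne hE'T

/-- A component `E' ∉ 𝒪` is the closure of `E' ∖ ⋃₀ 𝒪`. [folklore] -/
theorem subset_closure_diff_sUnion_of_notMem (hS : IsClosed S) (hfin : (componentsIn S).Finite)
    (h𝒪 : 𝒪 ⊆ componentsIn S) {E' : Set X} (hE' : E' ∈ componentsIn S) (hE'𝒪 : E' ∉ 𝒪) :
    E' ⊆ closure (E' \ ⋃₀ 𝒪) := by
  -- adapted from `subset_closure_diff_of_mem_componentsIn` (AlterationsNormalFormBlowupParts.lean)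
  have hne := diff_sUnion_nonempty_of_notMem hS hfin h𝒪 hE' hE'𝒪
  have hne' : (E' ∩ (⋃₀ 𝒪)ᶜ).Nonempty := by rwa [← Set.sdiff_eq]
  have := subset_closure_inter_of_isPreirreducible_of_isOpen
    (componentsIn.isIrreducible hE').isPreirreducible
    (isClosed_sUnion_of_subset_componentsIn hS hfin h𝒪).isOpen_compl hne'
  rwa [← Set.sdiff_eq] at this

/-- **The strict transform of a component `E' ∉ 𝒪` is irreducible** under a morphism which is
an isomorphism off the closed union `⋃₀ 𝒪`. [folklore] -/
theorem isIrreducible_strictTransformSet_of_notMem (hS : IsClosed S)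
    (hfin : (componentsIn S).Finite) (h𝒪 : 𝒪 ⊆ componentsIn S)
    [IsIso (π ∣_ ⟨(⋃₀ 𝒪)ᶜ, (isClosed_sUnion_of_subset_componentsIn hS hfin h𝒪).isOpen_compl⟩)]
    {E' : Set X} (hE' : E' ∈ componentsIn S) (hE'𝒪 : E' ∉ 𝒪) :
    IsIrreducible (strictTransformSet π (⋃₀ 𝒪) E') := by
  -- adapted from `isIrreducible_strictTransformSet` (AlterationsNormalFormBlowupParts.lean)
  refine IsIrreducible.closure ?_
  refine isIrreducible_preimage_of_isIso_morphismRestrict π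
    ⟨(⋃₀ 𝒪)ᶜ, (isClosed_sUnion_of_subset_componentsIn hS hfin h𝒪).isOpen_compl⟩ ?_
    (Set.sdiff_subset_compl E' _)
  have hne := diff_sUnion_nonempty_of_notMem hS hfin h𝒪 hE' hE'𝒪
  rw [Set.sdiff_eq]
  exact ⟨Set.sdiff_eq (s := E') (t := ⋃₀ 𝒪) ▸ hne,
    isPreirreducible_inter_of_isOpen (componentsIn.isIrreducible hE').isPreirreducible
      (isClosed_sUnion_of_subset_componentsIn hS hfin h𝒪).isOpen_compl⟩

/-- **The strict transforms of the components `E' ∉ 𝒪` are pairwise incomparable** (and the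
component is recovered from its strict transform). [folklore] -/
theorem eq_of_strictTransformSet_subset_of_notMem (hS : IsClosed S)
    (hfin : (componentsIn S).Finite) (h𝒪 : 𝒪 ⊆ componentsIn S)
    [IsIso (π ∣_ ⟨(⋃₀ 𝒪)ᶜ, (isClosed_sUnion_of_subset_componentsIn hS hfin h𝒪).isOpen_compl⟩)]
    {E₁ E₂ : Set X} (hE₁ : E₁ ∈ componentsIn S) (hE₂ : E₂ ∈ componentsIn S) (hne₁ : E₁ ∉ 𝒪)
    (h : strictTransformSet π (⋃₀ 𝒪) E₁ ⊆ strictTransformSet π (⋃₀ 𝒪) E₂) : E₁ = E₂ := by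
  -- adapted from `eq_of_strictTransformSet_subset` (AlterationsNormalFormBlowupParts.lean)
  have hCc : IsClosed (⋃₀ 𝒪) := isClosed_sUnion_of_subset_componentsIn hS hfin h𝒪
  have h2c : IsClosed E₂ := componentsIn.isClosed hS hE₂
  have h1 : E₁ \ ⋃₀ 𝒪 ⊆ E₂ :=
    (diff_subset_image_strictTransformSet π hCc E₁).trans
      ((Set.image_mono h).trans (strictTransformSet.image_subset π _ h2c))
  have h12 : E₁ ⊆ E₂ :=
    (subset_closure_diff_sUnion_of_notMem hS hfin h𝒪 hE₁ hne₁).trans (closure_minimal h1 h2c)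
  exact Set.Subset.antisymm h12 ((mem_componentsIn_iff.mp hE₁).2.2 E₂
    (componentsIn.subset hE₂) (componentsIn.isIrreducible hE₂) h12)

/-- **The components of `S'` are the strict transforms of the components `E' ∉ 𝒪` of `S`**
when `S'` is their union and `π` is an isomorphism off `⋃₀ 𝒪` (they are irreducible, closed and
pairwise incomparable). [cite: DeJong1996, 4.27, p. 75] -/
theorem componentsIn_eq_image_strictTransformSet_of_sUnion (hS : IsClosed S)
    (hfin : (componentsIn S).Finite) (h𝒪 : 𝒪 ⊆ componentsIn S)
    [IsIso (π ∣_ ⟨(⋃₀ 𝒪)ᶜ, (isClosed_sUnion_of_subset_componentsIn hS hfin h𝒪).isOpen_compl⟩)]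
    {S' : Set X'} (hS' : S' = ⋃ E' ∈ componentsIn S \ 𝒪, strictTransformSet π (⋃₀ 𝒪) E') :
    componentsIn S' = strictTransformSet π (⋃₀ 𝒪) '' (componentsIn S \ 𝒪) := by
  -- adapted from `ncard_componentsIn_of_eq_biUnion_strictTransformSet` (AlterationsNormalFormBlowupParts.lean)
  rw [hS', ← Set.sUnion_image]
  refine componentsIn_sUnion_eq (hfin.sdiff.image _) ?_ ?_ ?_
  · rintro _ ⟨E', hE', rfl⟩
    exact isIrreducible_strictTransformSet_of_notMem π hS hfin h𝒪 hE'.1 hE'.2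
  · rintro _ ⟨E', -, rfl⟩
    exact strictTransformSet.isClosed π _ E'
  · rintro _ ⟨E₁, hE₁, rfl⟩ _ ⟨E₂, hE₂, rfl⟩ h
    rw [eq_of_strictTransformSet_subset_of_notMem π hS hfin h𝒪 hE₁.1 hE₂.1 hE₁.2 h]

/-- **Counting components through strict transforms, for a centre which is a union of
components**: with `S'` the union of the strict transforms of the components `E' ∉ 𝒪` of `S`
and `π` an isomorphism off `⋃₀ 𝒪`, `#S' + #𝒪 = #S` on irreducible components.
[cite: DeJong1996, 4.27, p. 76] [cite: DeJong1997, proof of Prop. 5.11, p. 619] -/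
theorem ncard_componentsIn_add_of_sUnion (hS : IsClosed S) (hfin : (componentsIn S).Finite)
    (h𝒪 : 𝒪 ⊆ componentsIn S)
    [IsIso (π ∣_ ⟨(⋃₀ 𝒪)ᶜ, (isClosed_sUnion_of_subset_componentsIn hS hfin h𝒪).isOpen_compl⟩)]
    {S' : Set X'} (hS' : S' = ⋃ E' ∈ componentsIn S \ 𝒪, strictTransformSet π (⋃₀ 𝒪) E') :
    (componentsIn S').ncard + 𝒪.ncard = (componentsIn S).ncard := by
  have hinj : Set.InjOn (strictTransformSet π (⋃₀ 𝒪)) (componentsIn S \ 𝒪) := by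
    intro E₁ hE₁ E₂ hE₂ h
    exact eq_of_strictTransformSet_subset_of_notMem π hS hfin h𝒪 hE₁.1 hE₂.1 hE₁.2 h.le
  rw [componentsIn_eq_image_strictTransformSet_of_sUnion π hS hfin h𝒪 hS', hinj.ncard_image]
  exact Set.ncard_sdiff_add_ncard_of_subset h𝒪 hfin

/-- **The number of components drops** by `#𝒪 ≥ 1` when the centre `⋃₀ 𝒪` is a non-empty
union of components (de Jong 1997: blowing up the orbit of a component removes all its
translates from the singular locus). [cite: DeJong1997, proof of Prop. 5.11, p. 619] -/
theorem ncard_componentsIn_lt_of_sUnion (hS : IsClosed S) (hfin : (componentsIn S).Finite)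
    (h𝒪 : 𝒪 ⊆ componentsIn S) (h𝒪ne : 𝒪.Nonempty)
    [IsIso (π ∣_ ⟨(⋃₀ 𝒪)ᶜ, (isClosed_sUnion_of_subset_componentsIn hS hfin h𝒪).isOpen_compl⟩)]
    {S' : Set X'} (hS' : S' = ⋃ E' ∈ componentsIn S \ 𝒪, strictTransformSet π (⋃₀ 𝒪) E') :
    (componentsIn S').ncard < (componentsIn S).ncard := by
  have h := ncard_componentsIn_add_of_sUnion π hS hfin h𝒪 hS'
  have hpos : 0 < 𝒪.ncard := (Set.ncard_pos (hfin.subset h𝒪)).mpr h𝒪ne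
  omega

/-- The same count on the irreducible components of the subspaces (the form of the stub's
conclusion, `Set.ncard` of `irreducibleComponents ↥S`). [cite: DeJong1997, proof of Prop. 5.11, p. 619] -/
theorem ncard_irreducibleComponents_lt_of_sUnion {X' X : Scheme.{0}} (π : X' ⟶ X) {S : Set X}
    {𝒪 : Set (Set X)} (hS : IsClosed S)
    (hfin : (componentsIn S).Finite) (h𝒪 : 𝒪 ⊆ componentsIn S) (h𝒪ne : 𝒪.Nonempty)
    [IsIso (π ∣_ ⟨(⋃₀ 𝒪)ᶜ, (isClosed_sUnion_of_subset_componentsIn hS hfin h𝒪).isOpen_compl⟩)]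
    {S' : Set X'} (hS' : S' = ⋃ E' ∈ componentsIn S \ 𝒪, strictTransformSet π (⋃₀ 𝒪) E') :
    (irreducibleComponents ↥S').ncard < (irreducibleComponents ↥S).ncard := by
  rw [← ncard_componentsIn_eq, ← ncard_componentsIn_eq]
  exact ncard_componentsIn_lt_of_sUnion π hS hfin h𝒪 h𝒪ne hS'

end Summit.ResolutionOfSingularities.ResolutionOfSingularities.Theorems

end
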